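import Literature.MathematicalPhysics.QuantumLattice.HubbardOneParticleCost
import Literature.MathematicalPhysics.QuantumLattice.ReducedBCSTorus
import HarnessLib

/-!
# A filling-uniform one-particle cost for eigenvectors of the Hubbard Hamiltonian

Trunk T-QLATTICE (family `hubbard`); sharpening of `HubbardOneParticleCost.lean`, written for the
support item `ParityGapClustering` of the route `HubbardSuperconductivity/ParityGapRigidity`.
There the cost of adding one electron to a sector ground state was bounded ON AVERAGE over the
orbitals, with a constant `∝ 2|Λ|/(2|Λ| - N)` degenerating at high filling. Here we choose the
BEST orbital instead: for an eigenvector `Hχ = Eχ` of `H = hamiltonian G t U` on a graph of maximal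
degree `≤ Δ` and the site `z` maximising `‖c†_{zτ} χ‖` (resp. `‖c_{zτ} χ‖`),
`Re ⟨c†_{zτ}χ, H c†_{zτ}χ⟩ ≤ (E + Δ|t| + |U|) ‖c†_{zτ}χ‖²` (resp. with `c_{zτ}`), uniformly in the
volume AND in the filling (`exists_creation_rayleigh_le`, `exists_annihilation_rayleigh_le`).
The point is the explicit commutator `[H, c†_{zτ}] = -t Σ_{x ∼ z} c†_{xτ} + U n_{z,-τ} c†_{zτ}`
(`hamiltonian_mul_creation_sub`, `hamiltonian_mul_annihilation_sub`): every term applied to `χ`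
has norm `≤ max_x ‖c†_{xτ} χ‖ = ‖c†_{zτ} χ‖`, so `⟨c†_zχ, [H, c†_z]χ⟩ = O(‖c†_zχ‖²)` rather than
`O(‖c†_zχ‖)`. Everything is proved; no definition. Tasaki (2020) §2.1 (variational principle),
§9.3 (the Hubbard Hamiltonian and its commutators); Essler et al. (2005) §2.1 eq. (2.8). [folklore]
-/

noncomputable section

namespace Literature.MathematicalPhysics.QuantumLattice

open Matrix Finset HubbardWave0 ThermodynamicLimit
open scoped ComplexOrder Matrix.Norms.L2Operator InnerProductSpace

variable {Λ : Type*} [LinearOrder Λ] [Fintype Λ] (G : SimpleGraph Λ) [DecidableRel G.Adj]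

/-! ### The commutators `[H, c†_{zτ}]` and `[H, c_{zτ}]` -/

/-- `[Σ_{x∼y,σ} c†_{xσ} c_{yσ}, c†_{zτ}] = Σ_{x ∼ z} c†_{xτ}` (`[c†_i c_l, c†_j] = δ_{lj} c†_i`).
Essler et al. (2005) §2.1 eq. (2.8); Tasaki (2020) §9.3. [folklore] -/
theorem hoppingSum_mul_creation_sub (z : Λ) (τ : Fin 2) :
    (∑ x : Λ, ∑ y : Λ, ∑ σ : Fin 2,
        if G.Adj x y then creation (orb x σ) * annihilation (orb y σ)
        else (0 : Matrix (Finset (Orb Λ)) (Finset (Orb Λ)) ℂ)) * creation (orb z τ) -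
      creation (orb z τ) * (∑ x : Λ, ∑ y : Λ, ∑ σ : Fin 2,
        if G.Adj x y then creation (orb x σ) * annihilation (orb y σ) else 0) =
      ∑ x : Λ, if G.Adj x z then creation (orb x τ) else 0 := by
  rw [Finset.sum_mul, Finset.mul_sum, ← Finset.sum_sub_distrib]
  refine Finset.sum_congr rfl fun x _ => ?_
  rw [Finset.sum_mul, Finset.mul_sum, ← Finset.sum_sub_distrib]
  have hterm : ∀ y, (∑ σ : Fin 2, if G.Adj x y then creation (orb x σ) * annihilation (orb y σ)
        else (0 : Matrix (Finset (Orb Λ)) (Finset (Orb Λ)) ℂ)) * creation (orb z τ) -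
      creation (orb z τ) * (∑ σ : Fin 2,
        if G.Adj x y then creation (orb x σ) * annihilation (orb y σ) else 0) =
      if y = z then (if G.Adj x z then creation (orb x τ) else 0) else 0 := by
    intro y
    rw [Finset.sum_mul, Finset.mul_sum, ← Finset.sum_sub_distrib]
    by_cases hA : G.Adj x y
    · simp only [hA, if_true]
      have hσ : ∀ σ : Fin 2, creation (orb x σ) * annihilation (orb y σ) * creation (orb z τ) -
          creation (orb z τ) * (creation (orb x σ) * annihilation (orb y σ)) =
          if y = z ∧ σ = τ then creation (orb x σ) else 0 := by
        intro σ
        rw [creation_mul_annihilation_commutator_creation]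
        congr 1
        exact propext orb_eq_orb_iff
      simp only [hσ]
      by_cases hy : y = z
      · subst hy
        simp only [true_and, if_true, hA]
        rw [Finset.sum_ite_eq' Finset.univ τ (fun σ => creation (orb x σ))]
        simp
      · simp [hy]
    · simp only [hA, if_false, zero_mul, mul_zero, sub_zero, Finset.sum_const_zero]
      by_cases hy : y = z
      · subst hy; simp [hA]
      · simp [hy]
  simp only [hterm]
  rw [Finset.sum_ite_eq' Finset.univ z]
  simp

/-- `[Σ_x n_{x↑} n_{x↓}, c†_{zτ}] = n_{z,-τ} c†_{zτ}`. Essler et al. (2005) §2.1 eq. (2.8);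
Tasaki (2020) §9.3. [folklore] -/
theorem interactionSum_mul_creation_sub (z : Λ) (τ : Fin 2) :
    ∃ τ' : Fin 2, τ' ≠ τ ∧
      (∑ x : Λ, numberOp x 0 * numberOp x 1) * creation (orb z τ) -
          creation (orb z τ) * (∑ x : Λ, numberOp x 0 * numberOp x 1) =
        numberOp z τ' * creation (orb z τ) := by
  have hexp : ∀ A B C : Matrix (Finset (Orb Λ)) (Finset (Orb Λ)) ℂ,
      A * B * C - C * (A * B) = A * (B * C - C * B) + (A * C - C * A) * B := by
    intro A B C; noncomm_ring
  have hsum : (∑ x : Λ, numberOp x 0 * numberOp x 1) * creation (orb z τ) -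
      creation (orb z τ) * (∑ x : Λ, numberOp x 0 * numberOp x 1) =
      ∑ x : Λ, (numberOp x 0 * (if τ = 1 ∧ z = x then creation (orb z τ) else 0) +
        (if τ = 0 ∧ z = x then creation (orb z τ) else 0) * numberOp x 1) := by
    rw [Finset.sum_mul, Finset.mul_sum, ← Finset.sum_sub_distrib]
    refine Finset.sum_congr rfl fun x _ => ?_
    rw [hexp, numberOp_commutator_creation, numberOp_commutator_creation]
  fin_cases τ
  · refine ⟨1, by decide, ?_⟩
    rw [hsum]
    simp only [Fin.zero_eta, Fin.isValue, zero_ne_one, false_and, if_false, mul_zero, zero_add,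
      true_and]
    rw [show (∑ x : Λ, (if z = x then creation (orb z 0) else 0) * numberOp x 1) =
        ∑ x : Λ, (if z = x then creation (orb z 0) * numberOp z 1 else 0) from
      Finset.sum_congr rfl fun x _ => by by_cases h : z = x <;> simp [h],
      Finset.sum_ite_eq Finset.univ z]
    simp only [Finset.mem_univ, if_true]
    -- `c†_{z↑} n_{z↓} = n_{z↓} c†_{z↑}`
    have hne : orb z 1 ≠ orb z 0 := by simp
    exact (number_mul_creation_of_ne hne).symm
  · refine ⟨0, by decide, ?_⟩
    rw [hsum]
    simp only [Fin.mk_one, Fin.isValue, one_ne_zero, false_and, if_false, zero_mul, add_zero,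
      true_and]
    rw [show (∑ x : Λ, numberOp x 0 * (if z = x then creation (orb z 1) else 0)) =
        ∑ x : Λ, (if z = x then numberOp z 0 * creation (orb z 1) else 0) from
      Finset.sum_congr rfl fun x _ => by by_cases h : z = x <;> simp [h],
      Finset.sum_ite_eq Finset.univ z]
    simp only [Finset.mem_univ, if_true]

/-- **`[H, c†_{zτ}] = -t Σ_{x ∼ z} c†_{xτ} + U n_{z,-τ} c†_{zτ}`** for the Hubbard Hamiltonian
`H = hamiltonian G t U`. Tasaki (2020) §9.3; Essler et al. (2005) §2.1. [folklore] -/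
theorem hamiltonian_mul_creation_sub (t U : ℝ) (z : Λ) (τ : Fin 2) :
    ∃ τ' : Fin 2, τ' ≠ τ ∧
      hamiltonian G t U * creation (orb z τ) - creation (orb z τ) * hamiltonian G t U =
        -(t : ℂ) • (∑ x : Λ, if G.Adj x z then creation (orb x τ) else 0) +
          (U : ℂ) • (numberOp z τ' * creation (orb z τ)) := by
  obtain ⟨τ', hτ', hV⟩ := interactionSum_mul_creation_sub z τ
  refine ⟨τ', hτ', ?_⟩
  rw [hamiltonian, add_mul, mul_add, smul_mul_assoc, smul_mul_assoc, mul_smul_comm, mul_smul_comm,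
    show ∀ a b c d : Matrix (Finset (Orb Λ)) (Finset (Orb Λ)) ℂ, a + b - (c + d) = (a - c) + (b - d)
      from fun a b c d => by abel,
    ← smul_sub, ← smul_sub, hoppingSum_mul_creation_sub, hV]

/-- `c_p n_a = n_a c_p` for `a ≠ p`. Essler et al. (2005) §2.1 eq. (2.8). [folklore] -/
theorem annihilation_mul_number_of_ne {ι : Type*} [LinearOrder ι] [Fintype ι] {a p : ι} (h : a ≠ p) :
    (annihilation p : Matrix (Finset ι) (Finset ι) ℂ) * (creation a * annihilation a) =
      creation a * annihilation a * annihilation p := by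
  have h1 := congrArg conjTranspose (number_mul_creation_of_ne (ι := ι) h)
  simp only [conjTranspose_mul, creation_conjTranspose, annihilation_conjTranspose] at h1
  exact h1

/-- **`[H, c_{zτ}] = t Σ_{x ∼ z} c_{xτ} - U n_{z,-τ} c_{zτ}`** (adjoint of
`hamiltonian_mul_creation_sub`). Tasaki (2020) §9.3; Essler et al. (2005) §2.1. [folklore] -/
theorem hamiltonian_mul_annihilation_sub (t U : ℝ) (z : Λ) (τ : Fin 2) :
    ∃ τ' : Fin 2, τ' ≠ τ ∧
      hamiltonian G t U * annihilation (orb z τ) - annihilation (orb z τ) * hamiltonian G t U =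
        (t : ℂ) • (∑ x : Λ, if G.Adj x z then annihilation (orb x τ) else 0) -
          (U : ℂ) • (numberOp z τ' * annihilation (orb z τ)) := by
  obtain ⟨τ', hτ', h⟩ := hamiltonian_mul_creation_sub G t U z τ
  refine ⟨τ', hτ', ?_⟩
  have hH : (hamiltonian G t U)ᴴ = hamiltonian G t U := (LiebThm1.hamiltonian_isHermitian G t U).eq
  have hn : (numberOp z τ' : Matrix (Finset (Orb Λ)) (Finset (Orb Λ)) ℂ)ᴴ = numberOp z τ' :=
    (numberAt_isHermitian (orb z τ')).eq
  have hne : orb z τ' ≠ orb z τ := by simp [hτ']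
  have hite : ∀ x : Λ, (if G.Adj x z then creation (orb x τ) else (0 : Matrix _ _ ℂ))ᴴ =
      if G.Adj x z then annihilation (orb x τ) else 0 := by
    intro x
    split_ifs
    · exact creation_conjTranspose _
    · exact conjTranspose_zero
  have hs1 : star (-(t : ℂ)) = -(t : ℂ) := by simp
  have hs2 : star (U : ℂ) = (U : ℂ) := by simp
  have h1 := congrArg conjTranspose h
  simp only [conjTranspose_sub, conjTranspose_mul, conjTranspose_add, conjTranspose_smul,
    conjTranspose_sum, hH, creation_conjTranspose, hn, hite, hs1, hs2] at h1
  -- `h1 : c H - H c = -t • Σ_{x∼z} c_{xτ} + U • (c_{zτ} n_{zτ'})`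
  rw [numberOp, annihilation_mul_number_of_ne hne, ← numberOp] at h1
  rw [← neg_sub, h1, neg_add, neg_smul, neg_neg, sub_eq_add_neg]

/-! ### The best orbital: uniform one-particle cost -/

omit [LinearOrder Λ] [DecidableRel G.Adj] in
/-- Cauchy–Schwarz for the `dotProduct` pairing, Euclidean norms. [folklore] -/
theorem norm_star_dotProduct_le_norm_toLp {m : Type*} [Fintype m] (a b : m → ℂ) :
    ‖star a ⬝ᵥ b‖ ≤ ‖(WithLp.toLp 2 a : EuclideanSpace ℂ m)‖ * ‖(WithLp.toLp 2 b : EuclideanSpace ℂ m)‖ := by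
  rw [star_dotProduct_eq_inner]
  exact norm_inner_le_norm _ _

omit [LinearOrder Λ] [DecidableRel G.Adj] in
/-- The Euclidean norm of `Σ_{x ∼ z} v_x` is at most `Δ · max ‖v_x‖` on a graph of degree `≤ Δ`.
[folklore] -/
theorem norm_toLp_sum_ite_adj_le [DecidableRel G.Adj] {Δ : ℕ} (hΔ : ∀ x : Λ, #{y | G.Adj x y} ≤ Δ)
    (z : Λ) (v : Λ → Fock (Orb Λ)) {M : ℝ}
    (hM : ∀ x, ‖(WithLp.toLp 2 (v x) : EuclideanSpace ℂ (Finset (Orb Λ)))‖ ≤ M) :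
    ‖(WithLp.toLp 2 (∑ x : Λ, if G.Adj x z then v x else 0) : EuclideanSpace ℂ (Finset (Orb Λ)))‖ ≤
      Δ * M := by
  have hM0 : 0 ≤ M := (norm_nonneg _).trans (hM z)
  rw [WithLp.toLp_sum]
  calc ‖∑ x : Λ, (WithLp.toLp 2 (if G.Adj x z then v x else 0) : EuclideanSpace ℂ (Finset (Orb Λ)))‖
      ≤ ∑ x : Λ, ‖(WithLp.toLp 2 (if G.Adj x z then v x else 0) : EuclideanSpace ℂ (Finset (Orb Λ)))‖ :=
        norm_sum_le _ _
    _ = ∑ x ∈ Finset.univ.filter (fun x => G.Adj x z),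
          ‖(WithLp.toLp 2 (v x) : EuclideanSpace ℂ (Finset (Orb Λ)))‖ := by
        rw [Finset.sum_filter]
        refine Finset.sum_congr rfl fun x _ => ?_
        split_ifs <;> simp
    _ ≤ ∑ _x ∈ Finset.univ.filter (fun x => G.Adj x z), M := Finset.sum_le_sum fun x _ => hM x
    _ = #{x | G.Adj x z} * M := by rw [Finset.sum_const, nsmul_eq_mul]
    _ = #{x | G.Adj z x} * M := by
        have : (Finset.univ.filter fun x => G.Adj x z) = Finset.univ.filter fun x => G.Adj z x := by
          ext x
          simp only [Finset.mem_filter, Finset.mem_univ, true_and]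
          exact G.adj_comm _ _
        rw [this]
    _ ≤ Δ * M := by
        have : (#{x | G.Adj z x} : ℝ) ≤ Δ := by exact_mod_cast hΔ z
        exact mul_le_mul_of_nonneg_right this hM0

omit [LinearOrder Λ] in
/-- The common variational step: if `Hφ = Eφ + w` with `|⟨φ, w⟩| ≤ κ ‖φ‖²` then
`Re ⟨φ, Hφ⟩ ≤ (E + κ) ‖φ‖²`. Tasaki (2020) §2.1. [folklore] -/
theorem re_expect_le_of_split (H : Matrix (Finset (Orb Λ)) (Finset (Orb Λ)) ℂ) {φ w : Fock (Orb Λ)}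
    {E κ : ℝ} (hsplit : H *ᵥ φ = (E : ℂ) • φ + w)
    (hw : ‖(WithLp.toLp 2 w : EuclideanSpace ℂ (Finset (Orb Λ)))‖ ≤
      κ * ‖(WithLp.toLp 2 φ : EuclideanSpace ℂ (Finset (Orb Λ)))‖) :
    (expect H φ).re ≤ (E + κ) * (star φ ⬝ᵥ φ).re := by
  have hre : (star φ ⬝ᵥ φ).re = ‖(WithLp.toLp 2 φ : EuclideanSpace ℂ (Finset (Orb Λ)))‖ ^ 2 :=
    (norm_toLp_sq φ).symm
  rw [expect, hsplit, dotProduct_add, dotProduct_smul, smul_eq_mul, Complex.add_re,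
    Complex.re_ofReal_mul, hre]
  have h1 : (star φ ⬝ᵥ w).re ≤ κ * ‖(WithLp.toLp 2 φ : EuclideanSpace ℂ (Finset (Orb Λ)))‖ ^ 2 :=
    calc (star φ ⬝ᵥ w).re ≤ ‖star φ ⬝ᵥ w‖ := Complex.re_le_norm _
      _ ≤ ‖(WithLp.toLp 2 φ : EuclideanSpace ℂ (Finset (Orb Λ)))‖ *
            ‖(WithLp.toLp 2 w : EuclideanSpace ℂ (Finset (Orb Λ)))‖ := norm_star_dotProduct_le_norm_toLp φ w
      _ ≤ ‖(WithLp.toLp 2 φ : EuclideanSpace ℂ (Finset (Orb Λ)))‖ *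
            (κ * ‖(WithLp.toLp 2 φ : EuclideanSpace ℂ (Finset (Orb Λ)))‖) :=
          mul_le_mul_of_nonneg_left hw (norm_nonneg _)
      _ = κ * ‖(WithLp.toLp 2 φ : EuclideanSpace ℂ (Finset (Orb Λ)))‖ ^ 2 := by ring
  linarith

/-- **Uniform particle-addition cost.** If `Hχ = Eχ` for the Hubbard Hamiltonian on a graph of
maximal degree `≤ Δ` and some `c†_{zτ} χ ≠ 0`, then for the site `z` maximising `‖c†_{zτ} χ‖`,
`φ = c†_{zτ} χ ≠ 0` and `Re ⟨φ, Hφ⟩ ≤ (E + Δ|t| + |U|) ⟨φ, φ⟩`. Tasaki (2020) §2.1, §9.3. [folklore] -/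
theorem exists_creation_rayleigh_le {Δ : ℕ} (hΔ : ∀ x : Λ, #{y | G.Adj x y} ≤ Δ) (t U : ℝ)
    {χ : Fock (Orb Λ)} {E : ℝ} (hχ : hamiltonian G t U *ᵥ χ = (E : ℂ) • χ) (τ : Fin 2)
    (hex : ∃ z, creation (orb z τ) *ᵥ χ ≠ 0) :
    ∃ z, creation (orb z τ) *ᵥ χ ≠ 0 ∧
      (expect (hamiltonian G t U) (creation (orb z τ) *ᵥ χ)).re ≤
        (E + (Δ * |t| + |U|)) *
          (star (creation (orb z τ) *ᵥ χ) ⬝ᵥ (creation (orb z τ) *ᵥ χ)).re := by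
  classical
  set H := hamiltonian G t U with hH
  set f : Λ → ℝ := fun x =>
    ‖(WithLp.toLp 2 (creation (orb x τ) *ᵥ χ) : EuclideanSpace ℂ (Finset (Orb Λ)))‖ with hf
  obtain ⟨z₀, hz₀⟩ := hex
  obtain ⟨z, -, hzmax⟩ := Finset.exists_max_image Finset.univ f ⟨z₀, Finset.mem_univ _⟩
  have hfz₀ : 0 < f z₀ := by
    refine norm_pos_iff.2 fun h => hz₀ ?_
    have := congrArg WithLp.ofLp h
    simpa using this
  have hMpos : 0 < f z := lt_of_lt_of_le hfz₀ (hzmax z₀ (Finset.mem_univ _))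
  have hφ0 : creation (orb z τ) *ᵥ χ ≠ 0 := by
    intro h
    have : f z = 0 := by simp [hf, h]
    rw [this] at hMpos
    exact lt_irrefl _ hMpos
  refine ⟨z, hφ0, ?_⟩
  obtain ⟨τ', -, hcommf⟩ := hamiltonian_mul_creation_sub G t U z τ
  set φ := creation (orb z τ) *ᵥ χ with hφ
  have hsplit : H *ᵥ φ = (E : ℂ) • φ + (H * creation (orb z τ) - creation (orb z τ) * H) *ᵥ χ := by
    rw [hφ, sub_mulVec, ← mulVec_mulVec, ← mulVec_mulVec, hχ, mulVec_smul]; abel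
  refine re_expect_le_of_split H hsplit ?_
  rw [hcommf, add_mulVec, smul_mulVec, smul_mulVec, Matrix.sum_mulVec, WithLp.toLp_add,
    WithLp.toLp_smul, WithLp.toLp_smul]
  have hite : ∀ x : Λ, (if G.Adj x z then creation (orb x τ) else (0 : Matrix _ _ ℂ)) *ᵥ χ =
      if G.Adj x z then creation (orb x τ) *ᵥ χ else 0 := by
    intro x; split_ifs <;> simp
  simp only [hite]
  have h1 := norm_toLp_sum_ite_adj_le G hΔ z (fun x => creation (orb x τ) *ᵥ χ)
    (fun x => hzmax x (Finset.mem_univ _))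
  have h2 : ‖(WithLp.toLp 2 ((numberOp z τ' * creation (orb z τ)) *ᵥ χ) : EuclideanSpace ℂ (Finset (Orb Λ)))‖ ≤ f z := by
    rw [← mulVec_mulVec]
    refine (norm_toLp_mulVec_le _ _).trans ?_
    calc ‖numberOp z τ'‖ * ‖(WithLp.toLp 2 (creation (orb z τ) *ᵥ χ) : EuclideanSpace ℂ (Finset (Orb Λ)))‖
        ≤ 1 * f z := mul_le_mul_of_nonneg_right (norm_numberOp_le_one z τ') (norm_nonneg _)
      _ = f z := one_mul _
  calc ‖-(t : ℂ) • (WithLp.toLp 2 (∑ x : Λ, if G.Adj x z then creation (orb x τ) *ᵥ χ else 0) :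
            EuclideanSpace ℂ (Finset (Orb Λ))) +
          (U : ℂ) • (WithLp.toLp 2 ((numberOp z τ' * creation (orb z τ)) *ᵥ χ) :
            EuclideanSpace ℂ (Finset (Orb Λ)))‖
      ≤ ‖-(t : ℂ)‖ * ‖(WithLp.toLp 2 (∑ x : Λ, if G.Adj x z then creation (orb x τ) *ᵥ χ else 0) :
            EuclideanSpace ℂ (Finset (Orb Λ)))‖ +
          ‖(U : ℂ)‖ * ‖(WithLp.toLp 2 ((numberOp z τ' * creation (orb z τ)) *ᵥ χ) :
            EuclideanSpace ℂ (Finset (Orb Λ)))‖ :=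
        (norm_add_le _ _).trans (add_le_add (norm_smul_le _ _) (norm_smul_le _ _))
    _ ≤ |t| * (Δ * f z) + |U| * f z := by
        rw [norm_neg, Complex.norm_real, Complex.norm_real, Real.norm_eq_abs, Real.norm_eq_abs]
        exact add_le_add (mul_le_mul_of_nonneg_left h1 (abs_nonneg _))
          (mul_le_mul_of_nonneg_left h2 (abs_nonneg _))
    _ = (Δ * |t| + |U|) * f z := by ring

/-- **Uniform particle-removal cost.** If `Hχ = Eχ` for the Hubbard Hamiltonian on a graph of
maximal degree `≤ Δ` and some `c_{zτ} χ ≠ 0`, then for the site `z` maximising `‖c_{zτ} χ‖`,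
`φ = c_{zτ} χ ≠ 0` and `Re ⟨φ, Hφ⟩ ≤ (E + Δ|t| + |U|) ⟨φ, φ⟩`. Tasaki (2020) §2.1, §9.3. [folklore] -/
theorem exists_annihilation_rayleigh_le {Δ : ℕ} (hΔ : ∀ x : Λ, #{y | G.Adj x y} ≤ Δ) (t U : ℝ)
    {χ : Fock (Orb Λ)} {E : ℝ} (hχ : hamiltonian G t U *ᵥ χ = (E : ℂ) • χ) (τ : Fin 2)
    (hex : ∃ z, annihilation (orb z τ) *ᵥ χ ≠ 0) :
    ∃ z, annihilation (orb z τ) *ᵥ χ ≠ 0 ∧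
      (expect (hamiltonian G t U) (annihilation (orb z τ) *ᵥ χ)).re ≤
        (E + (Δ * |t| + |U|)) *
          (star (annihilation (orb z τ) *ᵥ χ) ⬝ᵥ (annihilation (orb z τ) *ᵥ χ)).re := by
  classical
  set H := hamiltonian G t U with hH
  set f : Λ → ℝ := fun x =>
    ‖(WithLp.toLp 2 (annihilation (orb x τ) *ᵥ χ) : EuclideanSpace ℂ (Finset (Orb Λ)))‖ with hf
  obtain ⟨z₀, hz₀⟩ := hex
  obtain ⟨z, -, hzmax⟩ := Finset.exists_max_image Finset.univ f ⟨z₀, Finset.mem_univ _⟩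
  have hfz₀ : 0 < f z₀ := by
    refine norm_pos_iff.2 fun h => hz₀ ?_
    have := congrArg WithLp.ofLp h
    simpa using this
  have hMpos : 0 < f z := lt_of_lt_of_le hfz₀ (hzmax z₀ (Finset.mem_univ _))
  have hφ0 : annihilation (orb z τ) *ᵥ χ ≠ 0 := by
    intro h
    have : f z = 0 := by simp [hf, h]
    rw [this] at hMpos
    exact lt_irrefl _ hMpos
  refine ⟨z, hφ0, ?_⟩
  obtain ⟨τ', -, hcommf⟩ := hamiltonian_mul_annihilation_sub G t U z τ
  set φ := annihilation (orb z τ) *ᵥ χ with hφ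
  have hsplit : H *ᵥ φ = (E : ℂ) • φ +
      (H * annihilation (orb z τ) - annihilation (orb z τ) * H) *ᵥ χ := by
    rw [hφ, sub_mulVec, ← mulVec_mulVec, ← mulVec_mulVec, hχ, mulVec_smul]; abel
  refine re_expect_le_of_split H hsplit ?_
  rw [hcommf, sub_mulVec, smul_mulVec, smul_mulVec, Matrix.sum_mulVec, WithLp.toLp_sub,
    WithLp.toLp_smul, WithLp.toLp_smul]
  have hite : ∀ x : Λ, (if G.Adj x z then annihilation (orb x τ) else (0 : Matrix _ _ ℂ)) *ᵥ χ =
      if G.Adj x z then annihilation (orb x τ) *ᵥ χ else 0 := by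
    intro x; split_ifs <;> simp
  simp only [hite]
  have h1 := norm_toLp_sum_ite_adj_le G hΔ z (fun x => annihilation (orb x τ) *ᵥ χ)
    (fun x => hzmax x (Finset.mem_univ _))
  have h2 : ‖(WithLp.toLp 2 ((numberOp z τ' * annihilation (orb z τ)) *ᵥ χ) :
      EuclideanSpace ℂ (Finset (Orb Λ)))‖ ≤ f z := by
    rw [← mulVec_mulVec]
    refine (norm_toLp_mulVec_le _ _).trans ?_
    calc ‖numberOp z τ'‖ * ‖(WithLp.toLp 2 (annihilation (orb z τ) *ᵥ χ) : EuclideanSpace ℂ (Finset (Orb Λ)))‖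
        ≤ 1 * f z := mul_le_mul_of_nonneg_right (norm_numberOp_le_one z τ') (norm_nonneg _)
      _ = f z := one_mul _
  calc ‖(t : ℂ) • (WithLp.toLp 2 (∑ x : Λ, if G.Adj x z then annihilation (orb x τ) *ᵥ χ else 0) :
            EuclideanSpace ℂ (Finset (Orb Λ))) -
          (U : ℂ) • (WithLp.toLp 2 ((numberOp z τ' * annihilation (orb z τ)) *ᵥ χ) :
            EuclideanSpace ℂ (Finset (Orb Λ)))‖
      ≤ ‖(t : ℂ)‖ * ‖(WithLp.toLp 2 (∑ x : Λ, if G.Adj x z then annihilation (orb x τ) *ᵥ χ else 0) :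
            EuclideanSpace ℂ (Finset (Orb Λ)))‖ +
          ‖(U : ℂ)‖ * ‖(WithLp.toLp 2 ((numberOp z τ' * annihilation (orb z τ)) *ᵥ χ) :
            EuclideanSpace ℂ (Finset (Orb Λ)))‖ :=
        (norm_sub_le _ _).trans (add_le_add (norm_smul_le _ _) (norm_smul_le _ _))
    _ ≤ |t| * (Δ * f z) + |U| * f z := by
        rw [Complex.norm_real, Complex.norm_real, Real.norm_eq_abs, Real.norm_eq_abs]
        exact add_le_add (mul_le_mul_of_nonneg_left h1 (abs_nonneg _))
          (mul_le_mul_of_nonneg_left h2 (abs_nonneg _))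
    _ = (Δ * |t| + |U|) * f z := by ring

end Literature.MathematicalPhysics.QuantumLattice
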